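import Summits.Ventures.CertifiedManyBodySolver.Transport.LTIPrimalHubbardChainEntTLM
import Literature.MathematicalPhysics.QuantumLattice.WindowEntropyConcavity
import Literature.MathematicalPhysics.QuantumLattice.SpinPartialTraceBimodule
import HarnessLib

/-!
# Ventures/CertifiedManyBodySolver — Transport/ChainWindowMidpoint.lean

Speedrun cell sr-mbsolver — LIT team (lit-1 gen-7), LEAD r118 (c) "STAGE 3" (window-level `G`-averaging transport for the
`G`-identified rows of op-08's formulation-B / ENT problem files), part A: THE MIDPOINT STEP.
HONEST FRAMING: first certified bounds; not a superconductivity verdict; every number certified or labelled float.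

WHAT THIS GIVES. op-08's `tl_marginal` problems identify the window variable `ρ` under a finite group `G` of signed permutations
of Fock states (spin flip, chain reflection, bipartite particle–hole; `code/oplayer/fockspace.py`), i.e. their certificates prove
`lo ≤ Re tr(h_avg ρ)` only for `G`-INVARIANT feasible `ρ`. The transport of such a node to the thermodynamic limit goes through an
EDGE to the `G`-free node `EntTLMChainNode` (`Rows/ChainMarginalNodes.lean`): a feasible `ρ` is replaced by its `G`-average, built by
successive midpoints `ρ ↦ ½(ρ + U ρ Uᴴ)`, one generator `U` at a time. This file proves the generator-independent half:

* every row of the ENT / `tl_marginal` node is MIDPOINT-CONVEX — positivity, trace one, any linear row (local translation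
  invariance), the `(N↑,N↓)`-sector zeros, any affine expectation row (density, objective), real entries; the bound `|ρ_{kk'}| ≤ 1`
  follows from positivity and trace one; and the ENTROPY ROW `0 ≤ S(ρ) − S(tr_{n+1} ρ)` is midpoint-concave (Lieb–Ruskai concavity of
  the conditional entropy, in the tree as lit-4's `entropy_sub_spinPartialTrace_avg_nonneg'`, fed with the two-block splitting
  `{-1,…,n+1} ≃ {-1,…,n} ⊕ {n+1}` of the window constructed here inside the proof);
* the midpoint `½(ρ + UρUᴴ)` is `U`-invariant as soon as `U²` acts trivially on `ρ` (`conj_midpoint_self`), and stays `V`-invariant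
  for any earlier generator `V` with `V (UρUᴴ) Vᴴ = UρUᴴ` (`conj_midpoint_of_invariant`).

Parts B (the three generators preserve the rows and the objective) and C (the symmetrised node predicates and the edges) follow in
sibling files. Nothing is asserted: every statement is a theorem about arbitrary matrices. No `sorry`, no new axiom, no definition.
[cite: LiebRuskai1973, Theorem 1] [cite: FawziFawziScalet2024Entropy, Theorem 4.1] [cite: KullEtAl2024, §II.B, §VI.B]
-/

noncomputable section

open Matrix Complex
open scoped ComplexOrder BigOperators
open Literature.Probability.LatticeModels
open Literature.MathematicalPhysics.QuantumLattice
open Literature.MathematicalPhysics.QuantumLattice.HubbardWave0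
open Literature.MathematicalPhysics.QuantumLattice.JordanWigner
open Literature.InformationTheory.Entropy (vonNeumannEntropy)

namespace Summit.Ventures.CertifiedManyBodySolver.Transport

/-! ### §1 Midpoint convexity of the rows (any site type) -/

section Generic

variable {X Y : Type} [Fintype X] [DecidableEq X] [Fintype Y] [DecidableEq Y] {q : ℕ}

/-- `0 ≤ 2⁻¹` in `ℂ` (Mathlib's partial order on `ℂ`). [folklore] -/
theorem inv_two_nonneg : (0 : ℂ) ≤ (2 : ℂ)⁻¹ := by
  rw [show (2 : ℂ)⁻¹ = ((2⁻¹ : ℝ) : ℂ) by push_cast; ring]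
  exact Complex.zero_le_real.mpr (by norm_num)

omit [Fintype Y] [DecidableEq Y] in
/-- Positivity is midpoint-convex. [folklore] -/
theorem posSemidef_midpoint {ρ₁ ρ₂ : Op Y q} (h₁ : ρ₁.PosSemidef) (h₂ : ρ₂.PosSemidef) :
    ((2 : ℂ)⁻¹ • (ρ₁ + ρ₂)).PosSemidef :=
  (h₁.add h₂).smul inv_two_nonneg

/-- Trace one is midpoint-affine. [folklore] -/
theorem trace_midpoint {ρ₁ ρ₂ : Op Y q} (h₁ : ρ₁.trace = 1) (h₂ : ρ₂.trace = 1) :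
    ((2 : ℂ)⁻¹ • (ρ₁ + ρ₂)).trace = 1 := by
  rw [Matrix.trace_smul, Matrix.trace_add, h₁, h₂, smul_eq_mul]
  norm_num

omit [Fintype X] [DecidableEq X] [Fintype Y] [DecidableEq Y] in
/-- A linear row `T₁ ρ = T₂ ρ` (e.g. local translation invariance, `T_i` two partial traces) is midpoint-convex. [folklore] -/
theorem linearRow_midpoint (T₁ T₂ : Op Y q →ₗ[ℂ] Op X q) {ρ₁ ρ₂ : Op Y q} (h₁ : T₁ ρ₁ = T₂ ρ₁) (h₂ : T₁ ρ₂ = T₂ ρ₂) :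
    T₁ ((2 : ℂ)⁻¹ • (ρ₁ + ρ₂)) = T₂ ((2 : ℂ)⁻¹ • (ρ₁ + ρ₂)) := by
  rw [map_smul, map_smul, map_add, map_add, h₁, h₂]

omit [Fintype Y] [DecidableEq Y] in
/-- A structural zero is midpoint-convex. [folklore] -/
theorem apply_midpoint_eq_zero {ρ₁ ρ₂ : Op Y q} {k k' : TensorIndex Y q} (h₁ : ρ₁ k k' = 0) (h₂ : ρ₂ k k' = 0) :
    ((2 : ℂ)⁻¹ • (ρ₁ + ρ₂)) k k' = 0 := by
  rw [Matrix.smul_apply, Matrix.add_apply, h₁, h₂, add_zero, smul_zero]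

/-- An expectation row `Re tr(A ρ) = v` is midpoint-affine. [folklore] -/
theorem re_trace_mul_midpoint (A : Op Y q) {ρ₁ ρ₂ : Op Y q} {v : ℝ} (h₁ : ((A * ρ₁).trace).re = v)
    (h₂ : ((A * ρ₂).trace).re = v) : ((A * ((2 : ℂ)⁻¹ • (ρ₁ + ρ₂))).trace).re = v := by
  rw [Matrix.mul_smul, Matrix.mul_add, Matrix.trace_smul, Matrix.trace_add, smul_eq_mul, Complex.mul_re, Complex.add_re,
    Complex.add_im, h₁, h₂]
  norm_num
  ring

omit [Fintype Y] [DecidableEq Y] in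
/-- Real entries are midpoint-convex. [folklore] -/
theorem conj_apply_midpoint {ρ₁ ρ₂ : Op Y q} (h₁ : ∀ k k', starRingEnd ℂ (ρ₁ k k') = ρ₁ k k')
    (h₂ : ∀ k k', starRingEnd ℂ (ρ₂ k k') = ρ₂ k k') (k k' : TensorIndex Y q) :
    starRingEnd ℂ (((2 : ℂ)⁻¹ • (ρ₁ + ρ₂)) k k') = ((2 : ℂ)⁻¹ • (ρ₁ + ρ₂)) k k' := by
  rw [Matrix.smul_apply, Matrix.add_apply, smul_eq_mul, map_mul, map_add, h₁, h₂, map_inv₀, map_ofNat]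

/-- **The entropy row is midpoint-concave** (concavity of the conditional entropy `S(ρ) − S(tr_C ρ)`, Lieb–Ruskai): for a window
`Y ≃ K ⊕ C` whose kept block `K` enters along `φK` (`φK = inl ≫ ε⁻¹`), if two density matrices satisfy `0 ≤ S(ρ_i) − S(tr_C ρ_i)` then
so does their midpoint. (lit-4's `entropy_sub_spinPartialTrace_avg_nonneg'` with the two-element index type.)
[cite: LiebRuskai1973, Theorem 1] [cite: FawziFawziScalet2024Entropy, Theorem 4.1] -/
theorem entropy_sub_spinPartialTrace_midpoint_nonneg {K C : Type} [Fintype K] [DecidableEq K] [Fintype C] [DecidableEq C]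
    (ε : Y ≃ K ⊕ C) {φK : K ↪ Y} (hK : φK = (Function.Embedding.inl : K ↪ K ⊕ C).trans ε.symm.toEmbedding)
    {ρ₁ ρ₂ : Op Y q} (h₁ : ρ₁.PosSemidef) (h₂ : ρ₂.PosSemidef) (ht₁ : ρ₁.trace = 1) (ht₂ : ρ₂.trace = 1)
    (he₁ : 0 ≤ vonNeumannEntropy ρ₁ - vonNeumannEntropy (spinPartialTrace φK ρ₁))
    (he₂ : 0 ≤ vonNeumannEntropy ρ₂ - vonNeumannEntropy (spinPartialTrace φK ρ₂)) :
    0 ≤ vonNeumannEntropy ((2 : ℂ)⁻¹ • (ρ₁ + ρ₂)) -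
      vonNeumannEntropy (spinPartialTrace φK ((2 : ℂ)⁻¹ • (ρ₁ + ρ₂))) := by
  have hσ : ∀ g : Fin 2, (![ρ₁, ρ₂] g).PosSemidef := fun g => by fin_cases g <;> assumption
  have htr : ∀ g : Fin 2, (![ρ₁, ρ₂] g).trace = 1 := fun g => by fin_cases g <;> assumption
  have hpos : ∀ g : Fin 2, 0 ≤ vonNeumannEntropy (![ρ₁, ρ₂] g) -
      vonNeumannEntropy (spinPartialTrace φK (![ρ₁, ρ₂] g)) := fun g => by fin_cases g <;> assumption
  have key := entropy_sub_spinPartialTrace_avg_nonneg' ε hK (σ := ![ρ₁, ρ₂]) hσ htr hpos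
  have havg : (Fintype.card (Fin 2) : ℂ)⁻¹ • ∑ g : Fin 2, ![ρ₁, ρ₂] g = (2 : ℂ)⁻¹ • (ρ₁ + ρ₂) := by
    rw [Fintype.card_fin, Fin.sum_univ_two]
    rfl
  rwa [havg] at key

/-! ### §2 Conjugation and midpoints -/

/-- `U · ½(ρ₁ + ρ₂) · Uᴴ = ½(Uρ₁Uᴴ + Uρ₂Uᴴ)`. [folklore] -/
theorem conj_midpoint (U ρ₁ ρ₂ : Op Y q) :
    U * ((2 : ℂ)⁻¹ • (ρ₁ + ρ₂)) * Uᴴ = (2 : ℂ)⁻¹ • (U * ρ₁ * Uᴴ + U * ρ₂ * Uᴴ) := by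
  rw [Matrix.mul_smul, Matrix.smul_mul, Matrix.mul_add, Matrix.add_mul]

/-- **The midpoint `½(ρ + UρUᴴ)` is `U`-invariant** as soon as `U²` acts trivially on `ρ` (`U² = ±1` for the three generators
spin flip, reflection, particle–hole). [folklore] -/
theorem conj_midpoint_self (U ρ : Op Y q) (hU2 : (U * U) * ρ * (U * U)ᴴ = ρ) :
    U * ((2 : ℂ)⁻¹ • (ρ + U * ρ * Uᴴ)) * Uᴴ = (2 : ℂ)⁻¹ • (ρ + U * ρ * Uᴴ) := by
  rw [conj_midpoint, add_comm]
  congr 2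
  rw [Matrix.conjTranspose_mul] at hU2
  simpa only [Matrix.mul_assoc] using hU2

/-- **Earlier invariances survive**: if `ρ` is `V`-invariant and `V (UρUᴴ) Vᴴ = UρUᴴ` then the midpoint `½(ρ + UρUᴴ)` is
`V`-invariant. [folklore] -/
theorem conj_midpoint_of_invariant (U V ρ : Op Y q) (hV : V * ρ * Vᴴ = ρ) (hVU : V * (U * ρ * Uᴴ) * Vᴴ = U * ρ * Uᴴ) :
    V * ((2 : ℂ)⁻¹ • (ρ + U * ρ * Uᴴ)) * Vᴴ = (2 : ℂ)⁻¹ • (ρ + U * ρ * Uᴴ) := by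
  rw [conj_midpoint, hV, hVU]

/-- If `U` and `V` commute up to a phase and `ρ` is `V`-invariant then `V (UρUᴴ) Vᴴ = UρUᴴ`. [folklore] -/
theorem conj_conj_eq_of_commute_up_to_phase (U V ρ : Op Y q) (hV : V * ρ * Vᴴ = ρ) (s : ℂ) (hs : s * star s = 1)
    (hUV : V * U = s • (U * V)) : V * (U * ρ * Uᴴ) * Vᴴ = U * ρ * Uᴴ := by
  have h1 : V * (U * ρ * Uᴴ) * Vᴴ = (V * U) * ρ * (V * U)ᴴ := by
    rw [Matrix.conjTranspose_mul]
    simp only [Matrix.mul_assoc]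
  have hM : U * V * ρ * (U * V)ᴴ = U * ρ * Uᴴ := by
    calc U * V * ρ * (U * V)ᴴ = U * (V * ρ * Vᴴ) * Uᴴ := by
          rw [Matrix.conjTranspose_mul]
          simp only [Matrix.mul_assoc]
      _ = U * ρ * Uᴴ := by rw [hV]
  rw [h1, hUV, Matrix.conjTranspose_smul, Matrix.smul_mul, Matrix.smul_mul, Matrix.mul_smul, smul_smul, hs, one_smul, hM]

end Generic

/-! ### §3 The entropy row of the chain window `{-1, …, n+1}` (kept block `{-1, …, n}`, traced site `n+1`) -/

section Window

/-- **Midpoint-concavity of the ENT row of `EntTLMChainNode`.** For two density matrices on the window `{-1, …, n+1}` satisfying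
`0 ≤ S(ρ_i) − S(tr_{n+1} ρ_i)` (marginal on `{-1, …, n}` along `PolySite.incl`), the midpoint satisfies it too. The two-block
splitting `{-1, …, n+1} ≃ {-1, …, n} ⊕ {n+1}` required by the concavity lemma is assembled inside the proof (`Equiv.sumCompl`).
[cite: LiebRuskai1973, Theorem 1] [cite: FawziFawziScalet2024Entropy, Theorem 4.1] -/
theorem chainWindow_entropyRow_midpoint (n : ℕ) {ρ₁ ρ₂ : Op (PolySite (chainWindow (-1) ((n : ℤ) + 1))) 4}
    (h₁ : ρ₁.PosSemidef) (h₂ : ρ₂.PosSemidef) (ht₁ : ρ₁.trace = 1) (ht₂ : ρ₂.trace = 1)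
    (he₁ : 0 ≤ vonNeumannEntropy ρ₁ -
      vonNeumannEntropy (spinPartialTrace (PolySite.incl (chainWindow_mono_right (-1) (by omega : (n : ℤ) ≤ n + 1))) ρ₁))
    (he₂ : 0 ≤ vonNeumannEntropy ρ₂ -
      vonNeumannEntropy (spinPartialTrace (PolySite.incl (chainWindow_mono_right (-1) (by omega : (n : ℤ) ≤ n + 1))) ρ₂)) :
    0 ≤ vonNeumannEntropy ((2 : ℂ)⁻¹ • (ρ₁ + ρ₂)) -
      vonNeumannEntropy (spinPartialTrace (PolySite.incl (chainWindow_mono_right (-1) (by omega : (n : ℤ) ≤ n + 1)))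
        ((2 : ℂ)⁻¹ • (ρ₁ + ρ₂))) := by
  classical
  have hsub : chainWindow (-1) (n : ℤ) ⊆ chainWindow (-1) ((n : ℤ) + 1) := chainWindow_mono_right (-1) (by omega)
  -- the kept block
  let P : PolySite (chainWindow (-1) ((n : ℤ) + 1)) → Prop := fun y => ofLex y.1 ∈ chainWindow (-1) (n : ℤ)
  let e₁ : {y : PolySite (chainWindow (-1) ((n : ℤ) + 1)) // P y} ≃ PolySite (chainWindow (-1) (n : ℤ)) :=
    { toFun := fun y => PolySite.pt (ofLex y.1.1) y.2
      invFun := fun z => ⟨PolySite.incl hsub z, PolySite.ofLex_mem z⟩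
      left_inv := fun y => rfl
      right_inv := fun z => rfl }
  -- the traced site `n + 1`
  have htop : (fun _ => (n : ℤ) + 1 : Site 1) ∈ chainWindow (-1) ((n : ℤ) + 1) := by
    rw [mem_chainWindow]; omega
  have htop' : ¬ P (PolySite.pt (fun _ => (n : ℤ) + 1 : Site 1) htop) := by
    show ¬ ((fun _ => (n : ℤ) + 1 : Site 1) ∈ chainWindow (-1) (n : ℤ))
    rw [mem_chainWindow]; omega
  let e₂ : {y : PolySite (chainWindow (-1) ((n : ℤ) + 1)) // ¬ P y} ≃ Unit :=
    { toFun := fun _ => ()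
      invFun := fun _ => ⟨PolySite.pt (fun _ => (n : ℤ) + 1) htop, htop'⟩
      left_inv := fun y => by
        have hy := PolySite.ofLex_mem y.1
        have hy' : ¬ (ofLex y.1.1 ∈ chainWindow (-1) (n : ℤ)) := y.2
        rw [mem_chainWindow] at hy hy'
        have hc : ofLex y.1.1 0 = (n : ℤ) + 1 := by omega
        refine Subtype.ext (Subtype.ext ?_)
        show toLex (fun _ => (n : ℤ) + 1 : Site 1) = y.1.1
        have hfun : (fun _ => (n : ℤ) + 1 : Site 1) = ofLex y.1.1 :=
          funext fun i => by rw [Subsingleton.elim i 0]; exact hc.symm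
        rw [hfun]
        rfl
      right_inv := fun _ => rfl }
  let ε : PolySite (chainWindow (-1) ((n : ℤ) + 1)) ≃ PolySite (chainWindow (-1) (n : ℤ)) ⊕ Unit :=
    (Equiv.sumCompl P).symm.trans (Equiv.sumCongr e₁ e₂)
  have hK : PolySite.incl (chainWindow_mono_right (-1) (by omega : (n : ℤ) ≤ n + 1)) =
      (Function.Embedding.inl : _ ↪ _ ⊕ Unit).trans ε.symm.toEmbedding := by
    ext z
    rfl
  exact entropy_sub_spinPartialTrace_midpoint_nonneg ε hK h₁ h₂ ht₁ ht₂ he₁ he₂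

/-- **Entry bound from positivity and trace one** (recorded for the midpoint): `|ρ_{kk'}| ≤ 1` for the midpoint of two density
matrices. [folklore] -/
theorem norm_apply_midpoint_le_one {Y : Type} [Fintype Y] [DecidableEq Y] {q : ℕ} {ρ₁ ρ₂ : Op Y q}
    (h₁ : ρ₁.PosSemidef) (h₂ : ρ₂.PosSemidef) (ht₁ : ρ₁.trace = 1) (ht₂ : ρ₂.trace = 1) (k k' : TensorIndex Y q) :
    ‖((2 : ℂ)⁻¹ • (ρ₁ + ρ₂)) k k'‖ ≤ 1 :=
  norm_apply_le_one_of_posSemidef (posSemidef_midpoint h₁ h₂) (trace_midpoint ht₁ ht₂) k k'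

end Window

/-! ### §4 Product unitaries `⨂_y u_y`: covariance of the partial trace and invariance of the entropy row -/

section ProductUnitary

variable {X Y : Type} [Fintype X] [DecidableEq X] [Fintype Y] [DecidableEq Y] {q : ℕ}

omit [DecidableEq X] in
/-- The ranges of a site injection `φ` and of the inclusion of its complement are disjoint. [folklore] -/
theorem disjoint_rangeSites_compl (φ : X ↪ Y) :
    Disjoint (rangeSites φ) (rangeSites (Function.Embedding.subtype fun y : Y => y ∉ Set.range φ)) := by
  rw [Finset.disjoint_left]
  intro y hy hy'
  rw [mem_rangeSites_iff] at hy hy'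
  obtain ⟨z, rfl⟩ := hy'
  exact z.2 hy

/-- **A product operator splits along a site injection**: `⨂_y u_y = Γ_φ (⨂_x u_{φ x}) · Γ_ψ (⨂_{z ∉ φ(X)} u_z)` with `ψ` the
inclusion of the complement of the range. [cite: BratteliRobinsonII1997, §6.2.1] -/
theorem productOp_eq_spinEmbed_mul_spinEmbed (φ : X ↪ Y) (u : Y → Matrix (Fin q) (Fin q) ℂ) :
    productOp u = spinEmbed φ (productOp fun x => u (φ x)) *
      spinEmbed (Function.Embedding.subtype fun y : Y => y ∉ Set.range φ)
        (productOp fun z : {y : Y // y ∉ Set.range φ} => u z.1) := by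
  classical
  set v₁ : Y → Matrix (Fin q) (Fin q) ℂ := fun y => if y ∈ Set.range φ then u y else 1 with hv₁
  set v₂ : Y → Matrix (Fin q) (Fin q) ℂ := fun y => if y ∈ Set.range φ then 1 else u y with hv₂
  have h1 : spinEmbed φ (productOp fun x => u (φ x)) = productOp v₁ := by
    have hf : (fun x => u (φ x)) = fun x => v₁ (φ x) := funext fun x => by
      rw [hv₁]; simp only [Set.mem_range_self, if_true]
    rw [hf]
    exact spinEmbed_productOp φ v₁ fun z hz => by rw [hv₁]; simp only [hz, if_false]
  have h2 : spinEmbed (Function.Embedding.subtype fun y : Y => y ∉ Set.range φ)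
      (productOp fun z : {y : Y // y ∉ Set.range φ} => u z.1) = productOp v₂ := by
    have hf : (fun z : {y : Y // y ∉ Set.range φ} => u z.1) =
        fun z => v₂ ((Function.Embedding.subtype fun y : Y => y ∉ Set.range φ) z) := funext fun z => by
      rw [hv₂]; simp only [Function.Embedding.coe_subtype, z.2, if_false]
    rw [hf]
    refine spinEmbed_productOp _ v₂ fun y hy => ?_
    have hy' : y ∈ Set.range φ := by
      by_contra hc
      exact hy ⟨⟨y, hc⟩, rfl⟩
    rw [hv₂]; simp only [hy', if_true]
  rw [h1, h2, productOp_mul]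
  congr 1
  funext y
  by_cases hy : y ∈ Set.range φ
  · rw [hv₁, hv₂]; simp only [hy, if_true, Matrix.mul_one]
  · rw [hv₁, hv₂]; simp only [hy, if_false, Matrix.one_mul]

/-- **Covariance of the partial trace under product unitaries**: `tr_φ ((⨂u) σ (⨂u)ᴴ) = (⨂_x u_{φx}) (tr_φ σ) (⨂_x u_{φx})ᴴ`
(the factors on the traced-out sites cancel). [cite: NielsenChuang2010, §2.4.3 Box 2.6] [cite: BratteliRobinsonII1997, §6.2.1] -/
theorem spinPartialTrace_productOp_conj (φ : X ↪ Y) {u : Y → Matrix (Fin q) (Fin q) ℂ}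
    (hu : ∀ y, u y ∈ Matrix.unitaryGroup (Fin q) ℂ) (σ : Op Y q) :
    spinPartialTrace φ (productOp u * σ * (productOp u)ᴴ) =
      productOp (fun x => u (φ x)) * spinPartialTrace φ σ * (productOp fun x => u (φ x))ᴴ := by
  rw [productOp_eq_spinEmbed_mul_spinEmbed φ u]
  exact spinPartialTrace_productUnitary_conj φ _ (disjoint_rangeSites_compl φ) _
    (productOp_mem_unitaryGroup fun z => hu z.1) σ

/-- **The entropy row is invariant under product unitaries**: `S(UσUᴴ) − S(tr_φ (UσUᴴ)) = S(σ) − S(tr_φ σ)` for `U = ⨂_y u_y`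
with unitary factors and `σ` Hermitian. [cite: FawziFawziScalet2024Entropy, Theorem 4.1] [cite: NielsenChuang2010, Theorem 11.8 (3)] -/
theorem entropy_sub_spinPartialTrace_productOp_conj (φ : X ↪ Y) {u : Y → Matrix (Fin q) (Fin q) ℂ}
    (hu : ∀ y, u y ∈ Matrix.unitaryGroup (Fin q) ℂ) {σ : Op Y q} (hσ : σ.IsHermitian) :
    vonNeumannEntropy (productOp u * σ * (productOp u)ᴴ) -
        vonNeumannEntropy (spinPartialTrace φ (productOp u * σ * (productOp u)ᴴ)) =
      vonNeumannEntropy σ - vonNeumannEntropy (spinPartialTrace φ σ) := by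
  rw [productOp_eq_spinEmbed_mul_spinEmbed φ u]
  exact entropy_sub_spinPartialTrace_productUnitary_conj φ _ (disjoint_rangeSites_compl φ)
    (productOp_mem_unitaryGroup fun x => hu (φ x)) (productOp_mem_unitaryGroup fun z => hu z.1) hσ

end ProductUnitary

/-! ### §5 Signed permutations of configurations: entries, sector zeros and reality under conjugation -/

section SignedPerm

variable {Y : Type} [Fintype Y] [DecidableEq Y] {q : ℕ}

/-- **A signed permutation matrix acts on entries by relabelling**: if `U k l = [l = π k] · s k` then
`(U ρ Uᴴ)_{k k'} = s(k) · conj(s(k')) · ρ_{π k, π k'}`. [folklore] -/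
theorem signedPerm_conj_apply {U : Op Y q} (π : TensorIndex Y q → TensorIndex Y q) (s : TensorIndex Y q → ℂ)
    (hU : ∀ k l, U k l = if l = π k then s k else 0) (ρ : Op Y q) (k k' : TensorIndex Y q) :
    (U * ρ * Uᴴ) k k' = s k * star (s k') * ρ (π k) (π k') := by
  rw [Matrix.mul_apply, Fintype.sum_eq_single (π k')]
  · rw [Matrix.mul_apply, Fintype.sum_eq_single (π k)]
    · rw [hU, if_pos rfl, Matrix.conjTranspose_apply, hU, if_pos rfl]
      ring
    · intro l hl
      rw [hU, if_neg hl, zero_mul]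
  · intro l hl
    rw [Matrix.conjTranspose_apply, hU, if_neg hl, star_zero, mul_zero]

/-- **Sector zeros survive a signed permutation that maps sectors to sectors**: if `ρ_{l l'} = 0` whenever `l`, `l'` differ in
some conserved count `N_τ`, and `π` sends configurations with different `N_σ` to configurations differing in some `N_τ`, then
`U ρ Uᴴ` has the same sector zeros. (Spin flip: `N_↑ ∘ π = N_↓`; reflection: `N_σ ∘ π = N_σ`; particle–hole: `N_σ ∘ π = k − N_σ`.)
[folklore] -/
theorem sectorRow_signedPerm_conj {U : Op Y q} (π : TensorIndex Y q → TensorIndex Y q) (s : TensorIndex Y q → ℂ)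
    (hU : ∀ k l, U k l = if l = π k then s k else 0) {ι : Type} (N : ι → TensorIndex Y q → ℕ)
    (hπ : ∀ i k k', N i k ≠ N i k' → ∃ j, N j (π k) ≠ N j (π k'))
    {ρ : Op Y q} (hρ : ∀ i k k', N i k ≠ N i k' → ρ k k' = 0) (i : ι) (k k' : TensorIndex Y q) (hk : N i k ≠ N i k') :
    (U * ρ * Uᴴ) k k' = 0 := by
  obtain ⟨j, hj⟩ := hπ i k k' hk
  rw [signedPerm_conj_apply π s hU, hρ j _ _ hj, mul_zero]

/-- **Real entries survive a real signed permutation.** [folklore] -/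
theorem realRow_signedPerm_conj {U : Op Y q} (π : TensorIndex Y q → TensorIndex Y q) (s : TensorIndex Y q → ℂ)
    (hU : ∀ k l, U k l = if l = π k then s k else 0) (hs : ∀ k, star (s k) = s k)
    {ρ : Op Y q} (hρ : ∀ k k', starRingEnd ℂ (ρ k k') = ρ k k') (k k' : TensorIndex Y q) :
    starRingEnd ℂ ((U * ρ * Uᴴ) k k') = (U * ρ * Uᴴ) k k' := by
  have hs' : ∀ l, starRingEnd ℂ (s l) = s l := hs
  rw [signedPerm_conj_apply π s hU, map_mul, map_mul, hρ, hs', ← Complex.star_def, star_star, hs k']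

omit [DecidableEq Y] in
/-- **Product operators with signed-permutation factors are signed permutations of configurations**: if every `u_y a b =
[b = p_y a] · t_y a` then `(⨂u)_{k l} = [l = p ∘ k] · ∏_y t_y(k_y)`. [folklore] -/
theorem productOp_apply_of_signedPerm {u : Y → Matrix (Fin q) (Fin q) ℂ} (p : Y → Fin q → Fin q) (t : Y → Fin q → ℂ)
    (hu : ∀ y a b, u y a b = if b = p y a then t y a else 0) (k l : TensorIndex Y q) :
    productOp u k l = if l = (fun y => p y (k y)) then ∏ y, t y (k y) else 0 := by
  classical
  rw [productOp_apply]
  by_cases hl : l = fun y => p y (k y)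
  · rw [if_pos hl]
    refine Finset.prod_congr rfl fun y _ => ?_
    rw [hu, if_pos (congrFun hl y)]
  · rw [if_neg hl]
    obtain ⟨y, hy⟩ : ∃ y, l y ≠ p y (k y) := by
      by_contra h
      push Not at h
      exact hl (funext h)
    exact Finset.prod_eq_zero (Finset.mem_univ y) (by rw [hu, if_neg hy])

end SignedPerm


end Summit.Ventures.CertifiedManyBodySolver.Transport
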